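import Summits.BirchSwinnertonDyer.BirchSwinnertonDyer.Theorems.KolyvaginDepthDoorDepthTableSteinWuthrichRankThree18745a1TwistLValue
import HarnessLib

/-!
# Route `KolyvaginDepthDoor`, crux `KolyvaginDepthSupplyKN` (stmt-BirchSwinnertonDyer-22820) —
# DEPTH TABLE v14: the odd-rank row `18745a1` (at `p = 7`, rank discharged) CLOSED MODULO ONE `L`-VALUE VALUATION, and
# the instrument's PREDICTION of a non-zero depth-two Kolyvagin class from that value

Helper file of the lead prover of line `levelone` (kdd-p1 g18; `--supports stmt-BirchSwinnertonDyer-22820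
--as helper`); it closes nothing and BSD is NOT proved by it.

Compositions of `…RankThree18745a1` (row at `p = 7`, `d_K = −11`, `rank = 3` kernel) with `…RankThree18745a1TwistLValue`
(Skinner 2016 Thm. C + GZK on the rank-zero twist `T = E^{(−11)}`, minimal model `[0,−11,1,−17666,−846849]`, `L(T,1) ≈ 6.62`):

* `C18745a1.cruxBody_of_twistLValue` — modulo FOUR named print facts (Stein–Wuthrich 2013 Thm. 1.1, W. Zhang 2014 L8.4 (1) /
  Thm. 9.1, Skinner 2016 Thm. C, Gross–Zagier–Kolyvagin) the CLAUSE of the crux holds at `18745a1` as soon as `L(T,1) ≠ 0` and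
  `ord_7(L(T,1)/Ω_T) ≤ 0`.
* `C18745a1.exists_kolyvaginClass_depthTwo_ne_zero_of_LValue` — under the same two `L`-value hypotheses (and (γ)), for ANY
  `K` with `d_K = −11` there is a frame, a product `ℓ₁ℓ₂` of EXACTLY TWO Kolyvagin primes and a datum with `c_1(ℓ₁ℓ₂) ≢ 0
  (mod 7)`: the depth door's bit PREDICTED from the cyclotomic side, with no Kolyvagin-class computation.

Per curve; nothing class-wide (the open stub (S♭) is untouched); BSD is NOT proved by any of this.

References: [SteinWuthrich2013] Thm. 1.1; [WZhang2014] Lemma 8.4 (1), Thm. 9.1; [Skinner2016PacificMC] Thm. C (p. 173);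
[Darmon2004] Thm. 3.22; [GrossLMS1991] Prop. 3.7 (2); [CremonaAlgorithms1997] Table 1 (18745a1).
-/

set_option linter.dupNamespace false

noncomputable section

open scoped Classical NumberField

namespace Summit.BirchSwinnertonDyer.BirchSwinnertonDyer.Theorems.KolyvaginDepthDoor

open Literature.NumberTheory.EllipticCurves Literature.NumberTheory.EllipticCurves.ModularForms
  WeierstrassCurve NumberField IsDedekindDomain
open Summit.BirchSwinnertonDyer.BirchSwinnertonDyer.Theorems
open Summit.BirchSwinnertonDyer.BirchSwinnertonDyer.Rank2Observatory
open Summit.BirchSwinnertonDyer.BirchSwinnertonDyer.Rank1Residual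
open Summit.BirchSwinnertonDyer.Rank1Residual.Additive

namespace C18745a1

/-- **THE CRUX `KolyvaginDepthSupplyKN` AT THE RANK-THREE CURVE `18745a1` FROM ONE EXACT `L`-VALUE** (at `p = 7`). Granted
Stein–Wuthrich 2013 Thm. 1.1, W. Zhang 2014 Lemma 8.4 (1) / Thm. 9.1, Skinner 2016 Thm. C and Gross–Zagier–Kolyvagin BY NAME, the
CLAUSE of the crux holds at `W = 18745a1` VERBATIM as soon as the Heegner twist `T = E^{(−11)}` (minimal model
`[0,−11,1,−17666,−846849]`, conductor `2 268 145`) has `L(T, 1) ≠ 0` (numerically `≈ 6.62`) and `ord_7(L(T,1)/Ω_T) ≤ 0`.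
Chain: `natCard_selmerGroup_quadraticTwist_neg11_eq_one_of_LValue` and `cruxBody_of_twistSelmer`. CONDITIONAL on the four named
facts and the two `L`-value hypotheses; per curve; BSD is not proved by it. [cite: SteinWuthrich2013, Thm. 1.1 (p. 1758)]
[cite: WZhang2014, Lemma 8.4 (1) (p. 236), Thm. 9.1 (p. 240)] [cite: Skinner2016PacificMC, Thm. C (p. 173)] [cite: Darmon2004, Thm. 3.22] -/
theorem cruxBody_of_twistLValue
    (hSW : SteinWuthrich2013_sha_inf_torsionBy_eq_bot_of_two_le_rank)
    (h84 : Literature.NumberTheory.EllipticCurves.WZhang2014_lemma84_exists_minimal_kolyvaginClass_one_selmerCard)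
    (hSk : Skinner2016_padicValRat_bsd_rank_zero) (hGZK : rank_eq_analyticRank_of_analyticRank_le_one)
    (K : Type) [Field K] [NumberField K] (hK : IsImaginaryQuadratic K) (hD : NumberField.discr K = -11)
    (hL : haveI := isElliptic_twist11;
      ((⟨0, -11, 1, -17666, -846849⟩ : WeierstrassCurve ℤ).map (Int.castRingHom ℚ)).entireLFunction 1 ≠ 0)
    (hval : haveI := isElliptic_twist11; haveI := isGloballyMinimal_twist11;
      ∀ q : ℚ, ((⟨0, -11, 1, -17666, -846849⟩ : WeierstrassCurve ℤ).map (Int.castRingHom ℚ)).entireLFunction 1 /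
          ((((⟨0, -11, 1, -17666, -846849⟩ : WeierstrassCurve ℤ).map (Int.castRingHom ℚ)).realPeriodRat : ℝ) : ℂ) = (q : ℂ) →
        padicValRat 7 q ≤ 0) :
    haveI := isElliptic_of_mem_atlasR3A00 mem_atlas;
    haveI := isGloballyMinimal_of_mem_atlasR3A00 mem_atlas;
    ∃ (p : ℕ) (hp : Fact p.Prime), 5 ≤ p ∧ (c18745a1.e.baseChange ℚ).HasGoodReductionAtPrime p ∧
      ¬ (p : ℤ) ∣ (c18745a1.e.baseChange ℚ).frobeniusTrace p ∧
      (∀ n : ℕ, (c18745a1.e.baseChange ℚ).HasSurjectiveModNGaloisRep (p ^ n : ℕ)) ∧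
      (∀ v : HeightOneSpectrum (𝓞 ℚ), (c18745a1.e.baseChange ℚ).HasMultiplicativeReductionAt v →
        ¬ p ∣ (c18745a1.e.baseChange ℚ).ordMinimalDiscriminant v) ∧
      ∃ (K : Type) (_ : Field K) (_ : NumberField K), IsImaginaryQuadratic K ∧
        NumberField.discr K ≠ -3 ∧ NumberField.discr K ≠ -4 ∧
        ∃ (_ : NeZero ((c18745a1.e.baseChange ℚ).conductorNorm ℤ)),
          SatisfiesHeegnerHypothesis ((c18745a1.e.baseChange ℚ).conductorNorm ℤ) K ∧
        ∃ (Dt : ModularParametrizationData (c18745a1.e.baseChange ℚ) ((c18745a1.e.baseChange ℚ).conductorNorm ℤ))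
          (β : ℤ) (ι : K →+* ℂ) (n₁ : ℕ) (d : KolyvaginHeegnerData Dt β ι n₁), Squarefree n₁ ∧
          (∀ q ∈ n₁.primeFactors,
            Zhang2014.IsKolyvaginPrime ((c18745a1.e.baseChange ℚ).conductorNorm ℤ) (c18745a1.e.baseChange ℚ) K p q) ∧
          d.kolyvaginClass hp.out 1 ≠ 0 ∧
          (n₁.primeFactors.card + 1 ≤ (c18745a1.e.baseChange ℚ).mordellWeilRank ∨
            (n₁.primeFactors.card ≤ (c18745a1.e.baseChange ℚ).mordellWeilRank ∧
              n₁.primeFactors.card + 1 ≤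
                ((c18745a1.e.baseChange ℚ).quadraticTwist (NumberField.discr K : ℚ)).mordellWeilRank)) := by
  haveI := isElliptic_of_mem_atlasR3A00 mem_atlas
  haveI := isGloballyMinimal_of_mem_atlasR3A00 mem_atlas
  have h1 := natCard_selmerGroup_quadraticTwist_neg11_eq_one_of_LValue hSk hGZK hL hval
  refine cruxBody_of_twistSelmer hSW h84 K hK hD ?_
  have hcast : (NumberField.discr K : ℚ) = (-11 : ℚ) := by rw [hD]; norm_num
  rw [hcast, h1]
  norm_num

/-- **THE INSTRUMENT'S PREDICTION AT `18745a1` FROM ONE `L`-VALUE** (at `p = 7`; (γ), W. Zhang, SW, Skinner, GZK by name). IF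
the rank-zero twist `T = E^{(−11)}` has `L(T,1) ≠ 0` and `ord_7(L(T,1)/Ω_T) ≤ 0`, THEN for ANY imaginary quadratic `K` with
`d_K = −11` there ARE a frame, a square-free product `n₁ = ℓ₁ℓ₂` of EXACTLY TWO Kolyvagin primes (for `p = 7`) and a datum of
conductor `n₁` with `c_1(ℓ₁ℓ₂) ≢ 0 (mod 7)` (`exactRowDepthTwo_7_neg11_iff_twistSelmer` ← `#Sel_7(E^{(−11)}) = 1 ≤ 49`) — a
falsifiable depth-2 prediction obtained with no Kolyvagin-class computation. CONDITIONAL on the five named facts and the two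
`L`-value hypotheses; per curve; BSD is not proved by it. [cite: Skinner2016PacificMC, Thm. C (p. 173)]
[cite: WZhang2014, Lemma 8.4 (1) (p. 236)] [cite: GrossLMS1991, Prop. 3.7 (2)] [cite: JetchevLauterStein2009, §3.6 (arXiv:0707.0032)] -/
theorem exists_kolyvaginClass_depthTwo_ne_zero_of_LValue
    (hSW : SteinWuthrich2013_sha_inf_torsionBy_eq_bot_of_two_le_rank)
    (h372 : GrossLMS1991.prop37_2_frobeniusCongruence)
    (h84 : Literature.NumberTheory.EllipticCurves.WZhang2014_lemma84_exists_minimal_kolyvaginClass_one_selmerCard)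
    (hSk : Skinner2016_padicValRat_bsd_rank_zero) (hGZK : rank_eq_analyticRank_of_analyticRank_le_one)
    (K : Type) [Field K] [NumberField K] (hK : IsImaginaryQuadratic K) (hD : NumberField.discr K = -11)
    (hL : haveI := isElliptic_twist11;
      ((⟨0, -11, 1, -17666, -846849⟩ : WeierstrassCurve ℤ).map (Int.castRingHom ℚ)).entireLFunction 1 ≠ 0)
    (hval : haveI := isElliptic_twist11; haveI := isGloballyMinimal_twist11;
      ∀ q : ℚ, ((⟨0, -11, 1, -17666, -846849⟩ : WeierstrassCurve ℤ).map (Int.castRingHom ℚ)).entireLFunction 1 /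
          ((((⟨0, -11, 1, -17666, -846849⟩ : WeierstrassCurve ℤ).map (Int.castRingHom ℚ)).realPeriodRat : ℝ) : ℂ) = (q : ℂ) →
        padicValRat 7 q ≤ 0) :
    haveI := isElliptic_of_mem_atlasR3A00 mem_atlas;
    haveI := isGloballyMinimal_of_mem_atlasR3A00 mem_atlas;
    haveI : NeZero ((c18745a1.e.baseChange ℚ).conductorNorm ℤ) := neZero_conductorNorm_of_isElliptic _;
    haveI := Fact.mk (by norm_num : Nat.Prime 7);
    ∃ (Dt : ModularParametrizationData (c18745a1.e.baseChange ℚ) ((c18745a1.e.baseChange ℚ).conductorNorm ℤ)) (β : ℤ) (ι : K →+* ℂ) (n₁ : ℕ)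
      (d : KolyvaginHeegnerData Dt β ι n₁), Squarefree n₁ ∧
        (∀ q ∈ n₁.primeFactors, Zhang2014.IsKolyvaginPrime ((c18745a1.e.baseChange ℚ).conductorNorm ℤ) (c18745a1.e.baseChange ℚ) K 7 q) ∧
        n₁.primeFactors.card = 2 ∧ d.kolyvaginClass (p := 7) (by norm_num) 1 ≠ 0 := by
  haveI := isElliptic_of_mem_atlasR3A00 mem_atlas
  haveI := isGloballyMinimal_of_mem_atlasR3A00 mem_atlas
  haveI iNZ : NeZero ((c18745a1.e.baseChange ℚ).conductorNorm ℤ) := neZero_conductorNorm_of_isElliptic _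
  haveI i7 := Fact.mk (by norm_num : Nat.Prime 7)
  have h1 := natCard_selmerGroup_quadraticTwist_neg11_eq_one_of_LValue hSk hGZK hL hval
  refine (exactRowDepthTwo_7_neg11_iff_twistSelmer hSW h372 h84 K hK hD).mpr ?_
  have hcast : (NumberField.discr K : ℚ) = (-11 : ℚ) := by rw [hD]; norm_num
  rw [hcast, h1]
  norm_num

end C18745a1

end Summit.BirchSwinnertonDyer.BirchSwinnertonDyer.Theorems.KolyvaginDepthDoor

end
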